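import Summits.BirchSwinnertonDyer.BirchSwinnertonDyer.Theorems.GenusKolyvaginAtTwoEquivariantChebotarevAtTwoOffDiscField
import HarnessLib

/-!
# Route `GenusKolyvaginAtTwo`, crux L_T `PowDvdShaCardAtTwoRT` (stmt-BirchSwinnertonDyer-23242), LINE 18/19 stub 3a⁗, step (b),
# input I4 at `p = 2`: the TWO-CLASS Čebotarev of the weak swap oracle

Seat `bsd-line-gk2-p2` g16 (PROVER seat 2/3, cell `bsd-f1-sign2`), `--supports 23242 --as helper`; companion of
`…RTPrimeSwappingWeak` (the loop over the WEAK oracle). THEOREMS ONLY (no definition, no named fact, no `sorry`). BSD is not proved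
by any of this; neither is the crux.

Input I4 of the memo `Cruxes/PowDvdShaCardAtTwoRT/Lines/plus-descent-step-b-prop52.md` — the Čebotarev prime `l′` of ONE swap in
McCallum's proof of Prop. 5.2 (held text `book:editornd-l-functions-arithmetic` p0286, (10)–(12)) — asked, as McCallum does, for a
prime realising THREE prescriptions (`φ|_C = ψ`, `c_{M_r+1}(n)_{λ′} ≠ 0`, `c_{λ′} ≠ 0`); at `p = 2` three non-vanishing conditions
on order-`2` classes can be jointly unrealisable (an `𝔽₂`-plane is the union of its three lines: the «Klein-four obstruction», §2
of the memo). `…RTPrimeSwappingWeak` shows the loop only ever needs the LAST TWO: detect `γ = c_{M_r+1}(n)` (progress is then free)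
and the auxiliary class `c_aux` (for the `λ′`-term of the reciprocity sum). Both are killed by `2`, hence FIXED by complex
conjugation whatever their sign (`−x = x`), so the pair `{γ, c_aux}` is a `τ`-stable family with `π = id`; two distinct non-zero
elements of order `2` are `ℤ/2^M`-independent in McCallum's sense; and Q5R `EquivariantChebotarevAtTwoR` — PROVED in the tree
(`GenusExact.equivariantChebotarevAtTwo_of_not_isSquare`, p606279) — supplies infinitely many Kolyvagin primes `ℓ` at `2` of index
`≥ M` with `Frob_ℓ = Frob_∞` at whose place BOTH classes are locally non-zero. This file is that corollary:
`infinite_kolyvaginPrime_localization_ne_zero_pair` (and the one-class form `…_single`). The only hypothesis beyond the route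
habitat is Q5R's separation hypothesis (restriction to `K(E[2^M])` injective on `⟨x, y⟩`), carried verbatim.

References: [McCallumLMS1991] §3 Prop. 3.1 / Cor. 3.2, §5 proof of Prop. 5.2 (10)–(12); [GrossLMS1991] §9.
-/

set_option autoImplicit false
-- `Summit.<P>.<Sub>` repeats `BirchSwinnertonDyer` by the tree's layout convention (D-0017)
set_option linter.dupNamespace false

noncomputable section

open scoped Classical

namespace Summit.BirchSwinnertonDyer.BirchSwinnertonDyer.Theorems.GenusExact.PlusDescent

open WeierstrassCurve NumberField IsDedekindDomain Field
open Literature.NumberTheory.GaloisRepresentations Literature.NumberTheory.EllipticCurves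
open Literature.NumberTheory

/-! ## Classes killed by `2`: integer multiples and independence -/

section TwoTorsionClasses

variable {A : Type*} [AddCommGroup A]

/-- If `2 · x = 0` then an EVEN integer multiple of `x` vanishes. [folklore] -/
theorem zsmul_eq_zero_of_even_of_two_nsmul_eq_zero {x : A} (hx : 2 • x = 0) {a : ℤ} (ha : Even a) : a • x = 0 := by
  obtain ⟨k, rfl⟩ := ha
  rw [← two_mul, mul_comm, mul_smul, two_zsmul, ← two_nsmul, hx, smul_zero]

/-- If `2 · x = 0` then an ODD integer multiple of `x` is `x`. [folklore] -/
theorem zsmul_eq_self_of_odd_of_two_nsmul_eq_zero {x : A} (hx : 2 • x = 0) {a : ℤ} (ha : Odd a) : a • x = x := by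
  obtain ⟨k, rfl⟩ := ha
  rw [add_smul, one_smul, mul_comm, mul_smul, two_zsmul, ← two_nsmul, hx, smul_zero, zero_add]

/-- A non-zero element killed by `2` has additive order `2 = 2^1`. [folklore] -/
theorem addOrderOf_eq_two_pow_one {x : A} (hx : 2 • x = 0) (hx0 : x ≠ 0) : addOrderOf x = 2 ^ 1 := by
  haveI : Fact (Nat.Prime 2) := ⟨Nat.prime_two⟩
  rw [pow_one]
  exact addOrderOf_eq_prime hx hx0

/-- **Two distinct non-zero classes killed by `2` are independent** in McCallum's sense (§3, before Cor. 3.2: a relation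
`a·x + b·y = 0` forces `ord x ∣ a`, `ord y ∣ b`): reduce `a, b` mod `2`. [cite: McCallumLMS1991, §3 (definition before Cor. 3.2)] -/
theorem two_dvd_of_zsmul_add_zsmul_eq_zero {x y : A} (hx : 2 • x = 0) (hy : 2 • y = 0) (hx0 : x ≠ 0) (hy0 : y ≠ 0)
    (hxy : x ≠ y) {a b : ℤ} (h : a • x + b • y = 0) : (2 : ℤ) ∣ a ∧ (2 : ℤ) ∣ b := by
  rcases Int.even_or_odd a with ha | ha <;> rcases Int.even_or_odd b with hb | hb
  · exact ⟨ha.two_dvd, hb.two_dvd⟩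
  · rw [zsmul_eq_zero_of_even_of_two_nsmul_eq_zero hx ha, zsmul_eq_self_of_odd_of_two_nsmul_eq_zero hy hb, zero_add] at h
    exact absurd h hy0
  · rw [zsmul_eq_self_of_odd_of_two_nsmul_eq_zero hx ha, zsmul_eq_zero_of_even_of_two_nsmul_eq_zero hy hb, add_zero] at h
    exact absurd h hx0
  · rw [zsmul_eq_self_of_odd_of_two_nsmul_eq_zero hx ha, zsmul_eq_self_of_odd_of_two_nsmul_eq_zero hy hb] at h
    -- `x + y = 0` with `2y = 0` forces `x = y`
    have hneg : x = -y := eq_neg_of_add_eq_zero_left h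
    have hyy : -y = y := by
      rw [neg_eq_iff_add_eq_zero, ← two_nsmul]
      exact hy
    exact absurd (hneg.trans hyy) hxy

end TwoTorsionClasses

/-! ## The two-class Čebotarev at `2` (input I4 of the weak swap oracle) -/

section Chebotarev

/-- **One class.** On the Q5R habitat (`E/ℚ` non-CM, `Δ < 0`, `ρ_{E,2^∞}` onto; `K` imaginary quadratic, `K ≠ ℚ(√Δ_E)`; `c` the
non-trivial automorphism of `K`; `M ≥ 1`): for ONE non-zero class `x ∈ H¹(K, E[2^M])` killed by `2` and fixed by `c`, whose span
meets the inflation kernel trivially, there are infinitely many Kolyvagin primes `ℓ` at `2` of index `≥ M` with `Frob_ℓ = Frob_∞`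
on `K(E[2^M])` at whose place `x` is locally NON-ZERO (`x_λ ∉` the local kernel). Q5R with `r = 1`, `N₁ = M₁ = 1`.
[cite: McCallumLMS1991, §3 Cor. 3.2] -/
theorem infinite_kolyvaginPrime_localization_ne_zero_single
    (N : ℕ) [NeZero N] (W : WeierstrassCurve ℚ) [W.IsElliptic] [W.IsGloballyMinimal]
    (hcm : ¬ W.HasCM) (hΔ : W.Δ < 0) (K : Type) [Field K] [NumberField K]
    (hK : IsImaginaryQuadratic K) (hns : ¬ IsSquare ((NumberField.discr K : ℚ) * -|W.Δ|))
    (hρ : ∀ n : ℕ, W.HasSurjectiveModNGaloisRep (2 ^ n : ℕ)) (c : K ≃ₐ[ℚ] K) (hc : c ≠ 1)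
    (M : ℕ) (hM : 1 ≤ M) (x : galH1Torsion (W.baseChange K) ((2 ^ M : ℕ) : ℤ))
    (hx0 : x ≠ 0) (hx2 : 2 • x = 0) (hτx : conjAct W c ((2 ^ M : ℕ) : ℤ) x = x)
    (hres : ∀ a : ℤ, (∀ ρ ∈ torsionFixing (W.baseChange K) ((2 ^ M : ℕ) : ℤ),
      h1Eval (W.baseChange K) ((2 ^ M : ℕ) : ℤ) (a • x) ρ = 0) → a • x = 0) :
    Set.Infinite {ℓ : ℕ | FrobEqFrobInfty W K (2 ^ M) ℓ ∧ Zhang2014.IsKolyvaginPrime N W K 2 ℓ ∧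
      M ≤ Zhang2014.kolyvaginIndex W 2 ℓ ∧
      ∀ v : HeightOneSpectrum (𝓞 K), (ℓ : 𝓞 K) ∈ v.asIdeal →
        x ∉ (W.baseChange K).torsionLocalKer (v.adicCompletion K) ((2 ^ M : ℕ) : ℤ)} := by
  have hQ := equivariantChebotarevAtTwo_of_not_isSquare N W hcm hΔ K hK hns hρ c hc M hM 1 ![x] id
    (fun i ↦ by fin_cases i; exact hx0)
    (fun i ↦ by fin_cases i; exact hτx)
    (fun a ha i ↦ by
      fin_cases i
      simp only [Fin.sum_univ_one, Fin.isValue, Matrix.cons_val_zero] at ha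
      show ((addOrderOf x : ℕ) : ℤ) ∣ a 0
      rw [addOrderOf_dvd_iff_zsmul_eq_zero]
      exact ha)
    (fun a ha ↦ by
      simp only [Fin.sum_univ_one, Fin.isValue, Matrix.cons_val_zero] at ha ⊢
      exact hres (a 0) ha)
    ![1] (fun i ↦ by fin_cases i; exact addOrderOf_eq_two_pow_one hx2 hx0) ![1]
    (fun i ↦ by fin_cases i; exact le_rfl) (fun _ ↦ rfl)
  refine hQ.mono fun ℓ hℓ ↦ ⟨hℓ.1, hℓ.2.1, hℓ.2.2.1, fun v hv hxv ↦ ?_⟩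
  have h := hℓ.2.2.2 0 v hv 0
  rw [pow_zero, Nat.cast_one, one_smul] at h
  exact absurd (h.mp hxv) (by simp)

/-- **INPUT I4 AT `p = 2`: the two-class Čebotarev of the weak swap oracle.** On the Q5R habitat, for TWO non-zero classes
`x, y ∈ H¹(K, E[2^M])` killed by `2` and fixed by complex conjugation `c` (automatic for order-`2` eigenclasses: `−x = x`), whose
span meets the inflation kernel trivially (Q5R's separation hypothesis, verbatim on `⟨x, y⟩`), there are infinitely many Kolyvagin
primes `ℓ` at `2` of index `≥ M` with `Frob_ℓ = Frob_∞` on `K(E[2^M])` at whose place BOTH `x` and `y` are locally non-zero. In the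
swap of McCallum's Prop. 5.2 (`…RTPrimeSwappingWeak`): `x = c_{M_r+1}(n)` (detected class; its non-vanishing at `λ′` also makes
the `λ′`-term of (13) non-zero via Prop. 4.4) and `y = c_aux` (McCallum Prop. 2.1 / Lemma 5.3, tree
`GenusExact.AuxiliaryClass.exists_ne_zero_fixed_selmerLocalKer`). No third class, no prescribed character `ψ` — two non-zero
vectors are never jointly undetectable. Proof: Q5R (`equivariantChebotarevAtTwo_of_not_isSquare`) with `r = 2`, `π = id`,
`N_i = M_i = 1` if `x ≠ y` (independence: `two_dvd_of_zsmul_add_zsmul_eq_zero`), and the one-class form if `x = y`.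
[cite: McCallumLMS1991, §3 Cor. 3.2; §5 Prop. 5.2 (proof, (11)–(12))] -/
theorem infinite_kolyvaginPrime_localization_ne_zero_pair
    (N : ℕ) [NeZero N] (W : WeierstrassCurve ℚ) [W.IsElliptic] [W.IsGloballyMinimal]
    (hcm : ¬ W.HasCM) (hΔ : W.Δ < 0) (K : Type) [Field K] [NumberField K]
    (hK : IsImaginaryQuadratic K) (hns : ¬ IsSquare ((NumberField.discr K : ℚ) * -|W.Δ|))
    (hρ : ∀ n : ℕ, W.HasSurjectiveModNGaloisRep (2 ^ n : ℕ)) (c : K ≃ₐ[ℚ] K) (hc : c ≠ 1)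
    (M : ℕ) (hM : 1 ≤ M) (x y : galH1Torsion (W.baseChange K) ((2 ^ M : ℕ) : ℤ))
    (hx0 : x ≠ 0) (hy0 : y ≠ 0) (hx2 : 2 • x = 0) (hy2 : 2 • y = 0)
    (hτx : conjAct W c ((2 ^ M : ℕ) : ℤ) x = x) (hτy : conjAct W c ((2 ^ M : ℕ) : ℤ) y = y)
    (hres : ∀ a b : ℤ, (∀ ρ ∈ torsionFixing (W.baseChange K) ((2 ^ M : ℕ) : ℤ),
      h1Eval (W.baseChange K) ((2 ^ M : ℕ) : ℤ) (a • x + b • y) ρ = 0) → a • x + b • y = 0) :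
    Set.Infinite {ℓ : ℕ | FrobEqFrobInfty W K (2 ^ M) ℓ ∧ Zhang2014.IsKolyvaginPrime N W K 2 ℓ ∧
      M ≤ Zhang2014.kolyvaginIndex W 2 ℓ ∧
      ∀ v : HeightOneSpectrum (𝓞 K), (ℓ : 𝓞 K) ∈ v.asIdeal →
        x ∉ (W.baseChange K).torsionLocalKer (v.adicCompletion K) ((2 ^ M : ℕ) : ℤ) ∧
        y ∉ (W.baseChange K).torsionLocalKer (v.adicCompletion K) ((2 ^ M : ℕ) : ℤ)} := by
  by_cases hxy : x = y
  · -- one class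
    subst hxy
    have h1 := infinite_kolyvaginPrime_localization_ne_zero_single N W hcm hΔ K hK hns hρ c hc M hM x hx0 hx2 hτx
      (fun a ha ↦ by
        have h := hres a 0 (fun ρ hρ' ↦ by rw [zero_smul, add_zero]; exact ha ρ hρ')
        rwa [zero_smul, add_zero] at h)
    exact h1.mono fun ℓ hℓ ↦ ⟨hℓ.1, hℓ.2.1, hℓ.2.2.1, fun v hv ↦ ⟨hℓ.2.2.2 v hv, hℓ.2.2.2 v hv⟩⟩
  · -- two distinct classes: an independent `τ`-fixed pair
    have hord : ∀ i : Fin 2, addOrderOf (![x, y] i) = 2 ^ (![1, 1] : Fin 2 → ℕ) i := fun i ↦ by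
      fin_cases i
      · exact addOrderOf_eq_two_pow_one hx2 hx0
      · exact addOrderOf_eq_two_pow_one hy2 hy0
    have hQ := equivariantChebotarevAtTwo_of_not_isSquare N W hcm hΔ K hK hns hρ c hc M hM 2 ![x, y] id
      (fun i ↦ by fin_cases i <;> assumption)
      (fun i ↦ by fin_cases i <;> assumption)
      (fun a ha i ↦ by
        simp only [Fin.sum_univ_two, Fin.isValue, Matrix.cons_val_zero, Matrix.cons_val_one] at ha
        obtain ⟨h0, h1⟩ := two_dvd_of_zsmul_add_zsmul_eq_zero hx2 hy2 hx0 hy0 hxy ha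
        rw [hord i]
        fin_cases i
        · exact h0
        · exact h1)
      (fun a ha ↦ by
        simp only [Fin.sum_univ_two, Fin.isValue, Matrix.cons_val_zero, Matrix.cons_val_one] at ha ⊢
        exact hres (a 0) (a 1) ha)
      ![1, 1] hord ![1, 1] (fun i ↦ by fin_cases i <;> exact le_rfl) (fun _ ↦ rfl)
    refine hQ.mono fun ℓ hℓ ↦ ⟨hℓ.1, hℓ.2.1, hℓ.2.2.1, fun v hv ↦ ⟨fun hxv ↦ ?_, fun hyv ↦ ?_⟩⟩
    · have h := hℓ.2.2.2 0 v hv 0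
      rw [pow_zero, Nat.cast_one, one_smul] at h
      exact absurd (h.mp hxv) (by simp)
    · have h := hℓ.2.2.2 1 v hv 0
      rw [pow_zero, Nat.cast_one, one_smul] at h
      exact absurd (h.mp hyv) (by simp)

end Chebotarev

end Summit.BirchSwinnertonDyer.BirchSwinnertonDyer.Theorems.GenusExact.PlusDescent

end
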